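/-
Copyright (c) 2026 the pub-hodgecm-mathlib formalisation cell (harness21).  Prover seat hodgecm-mathlib-K2Liu-p02 (g9), Track B «K2-LIT» ∕ hLiu418
#184♮, Road I v3, unit U5 «THE CLOSE», FACE-D₀ row `h2₂`, brick (B1c′-1) FILE 3 (sequel) «the `hκ` letter shape of ★ p863332 from the Siegel readings»
(LEAD F0P6-plan (g15) BATCH #181 (5) ∕ #183 (1), tie desk typ3 fit notes 00:26:26Z OPTION 2, 2026-09-05).  THEOREMS ONLY.
-/
import Summits.HodgeConjecture.HodgeConjecture.Theorems.K2LiuLinePairKappaModelOnUnipotents   -- FILE 3: `pairRep_line_kappaModel_tmul` (+ ★ p863642, ★ p863400, ★ D8)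
import HarnessLib

/-!
# K2_Liu road (hLiu418 = stmt-HodgeConjecture-24832), FACE-D₀ row `h2₂`, brick (B1c′-1) FILE 3 (sequel): THE `hκ` LETTER SHAPE OF ★ p863332
# `K2LiuFirstTermLineLiftRankRowModelConj.h2Row_thetaSide_of_finLineModel_conj` FROM THE SIEGEL READINGS

Cell `pub/hodgecm-mathlib` (D-0151), Track B, build stream 29; helper lane `--supports stmt-HodgeConjecture-24832 --as helper`, count-neutral.

★ `K2LiuLinePairKappaModelOnUnipotents.pairRep_line_kappaModel_tmul` gives, for ONE `u ∈ N_Δ(𝔸)`, `M_q⁻¹ (ω(toDiagA u, 1) (M_q (Φ_∞ ⊗ φ))) = Φ_∞ ⊗ (ψ_f(q_{S_f}) · φ)`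
from the readings of `g⁻¹ ι(u ⊗ 1) g ∈ P_𝕐(𝔸)`.  This file packages it in the exact binder shape `hκ` of ★ p863332 (:209–:217; tie desk typ3 OPTION 2: the
section's finite-slot representation `ρf : Representation ℂ Z (FinSB …)` BY VALUE with ONE eq-letter `hρf`):
* **`exists_Tg_pairRep_line_of_readings`** — for `g`, a lift `q`, the membership letter `hj` (FILE 2's currency `g⁻¹ · toSp … (adelicInl (toDiagA p)) · g ∈ P_𝕐(T₁)`),
  an index map `ι : Z → N_Δ(𝔸)`, per-`z` readings `a⁻¹ = 1`, `−½ c = S z`, `(S z)_∞ = 0`, and `hρf : ρf z φ = ψ_f(q_{(S z)_f}) · φ`: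
  `∃ Tg, ∀ z Φ_∞ φ, Tg (pairRep … (toDiagA (ι z), 1) (Tg⁻¹ (Φ_∞ ⊗ φ))) = Φ_∞ ⊗ ρf z φ` (`Tg := M_q⁻¹`), binders `e₁ hdV0 hdW0 lam hlam a'` and the
  `pairRep … (chiSplittingLine …)` term VERBATIM as in ★ p863332;
* `aInvMat_eq_one_of_aMat_eq_one` — reading helper (`a_p = 1 ⇒ a_p⁻¹ = 1` on `P_𝕐`), so FILE 2 may export either Levi block;
* **`exists_Tg_pairRep_line_of_cayley`** — the instance at a RATIONAL mover `κ′ ∈ Sp_{2n″}(L⁺)`: `g := (ratSp κ′)⁻¹`, `q := r_F(κ′)⁻¹` (so `Tg = ω(r_F κ′)`, the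
  GLOBAL Cayley-mover model of the census (B1c′)), with `hj` and the readings in F0P2-p10 (g3)'s FILE 2 orientation `ratSp κ′ · ι(·) · (ratSp κ′)⁻¹`.

No definition, no instance, no notation, no named-fact hypothesis, no `sorry`; axioms ⊆ {propext, Classical.choice, Quot.sound}.  HONEST LABEL: HC_CM is proved
only modulo the 7 printed citations (2 remaining named inputs: hLiu418 = stmt-HodgeConjecture-24832, h413 = stmt-HodgeConjecture-24833) until rung 0 closes; this file
moves no counter: `h2₂` needs FILE 2's `hj` + readings at the line datum (F0P2-p10) and K2E3-p23's S-letters (`hρf`, `hι∞` ⇒ `(S z)_∞ = 0`, `hρm`, `hχ`, `hχS`, …).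

References: [Weil1964] A. Weil, Acta Math. 111 (1964), Chap. I n° 13 p. 160, n° 34 p. 184, Chap. III n° 40–41 pp. 190–193; [Kudla1994] S. S. Kudla, Israel J.
Math. 87 (1994), §3; [Liu2021] Y. Liu, Camb. J. Math. 9 (2021), App. B Prop. B.8 p. 104, App. D §D.1 Step 2; [GelbartRogawski1991] §3.1 Prop. 3.1.1 p. 455.
-/

set_option autoImplicit false
set_option linter.dupNamespace false
-- the line-pair carriers elaborate to very large types; elaborate sequentially (as in ★ `K2LiuFirstTermLineLiftRankRowModelConj`)
set_option Elab.async false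

noncomputable section

open NumberField NumberField.mixedEmbedding IsDedekindDomain
open scoped Matrix TensorProduct SchwartzMap Classical  -- `Classical`: the `Fintype` of real ∕ complex places inside `mixedSpace` (as ★ p863332, ★ p863400)

namespace Summit.HodgeConjecture.HodgeConjecture.Cruxes.HLiu418.K2LiuLinePairKappaModelLetter

open Literature.NumberTheory.Automorphic Literature.NumberTheory.Automorphic.UnitaryGroup Literature.NumberTheory.GaloisRepresentations
open Literature.NumberTheory.Automorphic.IdeleClassGroup
open Literature.NumberTheory.Automorphic.Liu2021 Literature.NumberTheory.Automorphic.Liu2021.Def411WeilCarriers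
open Literature.NumberTheory.Automorphic.Liu2021.Def411WeilCarriersDoubling
open Literature.RepresentationTheory.HeisenbergGroup Literature.RepresentationTheory.Liu2021
open Literature.NumberTheory.GelbartRogawski1991 Literature.NumberTheory.GelbartRogawski1991.UnitaryDualPair
open Literature.NumberTheory.GelbartRogawski1991.GRConstruction
open Literature.NumberTheory.K2Lit.SiegelDoubled Literature.NumberTheory.K2Lit.DoubledLineTheta
open Literature.NumberTheory.Weil1964
open Summit.HodgeConjecture.HodgeConjecture.Cruxes.HLiu418.K2LiuLinePairKappaModelOnUnipotents (pairRep_line_kappaModel_tmul)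

variable (L : Type) [Field L] [NumberField L] [IsCMField L]
variable {N M n : ℕ} (e : Fin N × Fin M ≃ Fin n)
  (dV : Fin N → L) (hdV : ∀ i, IsCMField.complexConj L (dV i) = dV i)
  (dW : Fin M → L) (hdW : ∀ i, IsCMField.complexConj L (dW i) = dW i)

/-! ## A reading helper: `a_p = 1 ⇒ a_p⁻¹ = 1` (FILE 2 may export either block) -/

section Reading

variable {K : Type*} [CommRing K] {ι : Type*} [Fintype ι] [DecidableEq ι] {T : Matrix ι ι K}

/-- for `p ∈ P_𝕐`, `a_p = 1 ⇒ a_p⁻¹ = 1` (★ `SiegelParabolicPi.aInvMat_mul_aMat`). [cite: Weil1964, Chap. III n° 46 p. 202] -/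
theorem aInvMat_eq_one_of_aMat_eq_one {p : symplecticGroup (polar (Matrix.toLinearMap₂' K T))} (hp : p ∈ siegelParabolicPi T)
    (ha : SiegelParabolicPi.aMat p = 1) : SiegelParabolicPi.aInvMat p = 1 := by
  have h := SiegelParabolicPi.aInvMat_mul_aMat hp
  rwa [ha, Matrix.mul_one] at h

end Reading

/-! ## The `hκ` SHAPE of ★ p863332: `∃ Tg, ∀ z Φ_∞ φ, Tg (ω(toDiagA (ι z), 1) (Tg⁻¹ (Φ_∞ ⊗ φ))) = Φ_∞ ⊗ ρf z φ` from the readings -/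

section Shape

variable {n'' : ℕ} (e₁ : Fin (n + n) × Fin 1 ≃ Fin n'') (hdV0 : ∀ i, dV i ≠ 0) (hdW0 : ∀ i, dW i ≠ 0)
  (lam : IdeleClassGroup L →ₜ* Circle) (hlam : IsConjugateSymplectic L lam) (a' : (Fp L)ˣ)

set_option maxHeartbeats 1000000 in -- idem
/-- **THE `hκ` LETTER OF ★ `K2LiuFirstTermLineLiftRankRowModelConj` FROM THE SIEGEL READINGS** (tie desk typ3 OPTION 2).  Data BY VALUE: `g ∈ Sp(𝕎_𝔸)` conjugating
`ι(P_Δ(𝔸) ⊗ 1)` into `P_𝕐(𝔸)` (`hj`) with a lift `q`; an index map `ι : Z → N_Δ(𝔸)` with, at every `z`, the readings `a⁻¹ = 1`, `−½ c = S z`, `(S z)_∞ = 0` of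
`g⁻¹ ι(ι z ⊗ 1) g`; a finite-slot representation `ρf` with the eq-letter `hρf : ρf z φ = ψ_f(q_{(S z)_f}) · φ`.  Then, with `Tg := M_q⁻¹`:
`∃ Tg, ∀ z Φ_∞ φ, Tg (ω(toDiagA (ι z), 1) (Tg⁻¹ (Φ_∞ ⊗ φ))) = Φ_∞ ⊗ ρf z φ` — the binder `hκ` of ★ p863332 :209–:217 verbatim.
[cite: Weil1964, Chap. I n° 13 p. 160, n° 34 p. 184] [cite: Kudla1994, §3] [cite: Liu2021, App. B Prop. B.8 p. 104] -/
theorem exists_Tg_pairRep_line_of_readings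
    (g : symplecticGroup (polar (adelicForm (Fp L) (Fin n'')
      (adelicGram (Fp L) e₁ (realDiagonal L (dD L e dV hdV dW hdW) (dD_conj L e dV hdV dW hdW)) (TW (Fp L) a')))))
    (q : adelicMp (Fp L) (Fin n'') (adelicGram (Fp L) e₁ (realDiagonal L (dD L e dV hdV dW hdW) (dD_conj L e dV hdV dW hdW)) (TW (Fp L) a')))
    (hqc : q ∈ adelicMpCont (Fp L) (Fin n'') (adelicGram (Fp L) e₁ (realDiagonal L (dD L e dV hdV dW hdW) (dD_conj L e dV hdV dW hdW)) (TW (Fp L) a')))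
    (hq : MpPsi.proj _ q = g)
    (hj : ∀ p : ↥(siegelDelta L e dV hdV dW hdW),
      g⁻¹ * toSp (Fp L) L (IsCMField.complexConj L) (n + n) 1 e₁ (Matrix.diagonal (dD L e dV hdV dW hdW)) (JW (Fp L) L a')
          (complexConj_imagUnit L) (imagUnit_ne_zero L) (imagUnit_mul_self L)
          (realDiagonal_isSymm L (dD L e dV hdV dW hdW) (dD_conj L e dV hdV dW hdW)) (isSymm_TW (Fp L) a')
          (realDiagonal_map L (dD L e dV hdV dW hdW) (dD_conj L e dV hdV dW hdW)).symm (JW_eq (Fp L) L a')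
          (UnitaryGroup.adelicInl (Fp L) L (IsCMField.complexConj L) (n + n) 1 (Matrix.diagonal (dD L e dV hdV dW hdW)) (JW (Fp L) L a')
            (toDiagA L e dV hdV dW hdW (p : HA L e dV hdV dW hdW))) * g ∈
        siegelParabolicPi (adelicGram (Fp L) e₁ (realDiagonal L (dD L e dV hdV dW hdW) (dD_conj L e dV hdV dW hdW)) (TW (Fp L) a')))
    {Z : Type*} [Group Z] (ι : Z → ↥(unipDelta L e dV hdV dW hdW)) (S : Z → Matrix (Fin n'') (Fin n'') (AdeleRing (𝓞 (Fp L)) (Fp L)))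
    (ha : ∀ z, SiegelParabolicPi.aInvMat (g⁻¹ *
        toSp (Fp L) L (IsCMField.complexConj L) (n + n) 1 e₁ (Matrix.diagonal (dD L e dV hdV dW hdW)) (JW (Fp L) L a')
          (complexConj_imagUnit L) (imagUnit_ne_zero L) (imagUnit_mul_self L)
          (realDiagonal_isSymm L (dD L e dV hdV dW hdW) (dD_conj L e dV hdV dW hdW)) (isSymm_TW (Fp L) a')
          (realDiagonal_map L (dD L e dV hdV dW hdW) (dD_conj L e dV hdV dW hdW)).symm (JW_eq (Fp L) L a')
          (UnitaryGroup.adelicInl (Fp L) L (IsCMField.complexConj L) (n + n) 1 (Matrix.diagonal (dD L e dV hdV dW hdW)) (JW (Fp L) L a')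
            (toDiagA L e dV hdV dW hdW ((ι z : ↥(unipDelta L e dV hdV dW hdW)) : HA L e dV hdV dW hdW))) * g) = 1)
    (hS : ∀ z, (-⅟(2 : AdeleRing (𝓞 (Fp L)) (Fp L))) • SiegelParabolicPi.cMat (g⁻¹ *
        toSp (Fp L) L (IsCMField.complexConj L) (n + n) 1 e₁ (Matrix.diagonal (dD L e dV hdV dW hdW)) (JW (Fp L) L a')
          (complexConj_imagUnit L) (imagUnit_ne_zero L) (imagUnit_mul_self L)
          (realDiagonal_isSymm L (dD L e dV hdV dW hdW) (dD_conj L e dV hdV dW hdW)) (isSymm_TW (Fp L) a')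
          (realDiagonal_map L (dD L e dV hdV dW hdW) (dD_conj L e dV hdV dW hdW)).symm (JW_eq (Fp L) L a')
          (UnitaryGroup.adelicInl (Fp L) L (IsCMField.complexConj L) (n + n) 1 (Matrix.diagonal (dD L e dV hdV dW hdW)) (JW (Fp L) L a')
            (toDiagA L e dV hdV dW hdW ((ι z : ↥(unipDelta L e dV hdV dW hdW)) : HA L e dV hdV dW hdW))) * g) = S z)
    (hS0 : ∀ z, (S z).map (archHom (Fp L)) = 0)
    (ρf : Representation ℂ Z (FinSB (Fp L) (Fin n'')))
    (hρf : ∀ (z : Z) (φ : FinSB (Fp L) (Fin n'')), ρf z φ =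
      finMulLM (finSdChar ((S z).map (RingHom.snd (InfiniteAdeleRing (Fp L)) (FiniteAdeleRing (𝓞 (Fp L)) (Fp L)))))
        (isLocallyConstant_finSdChar _) φ) :
    ∃ Tg : ↥(piSchwartzBruhat (Fp L) (Fin n'')) ≃ₗ[ℂ] ↥(piSchwartzBruhat (Fp L) (Fin n'')),
      ∀ (z : Z) (Φinf : 𝓢((Fin n'' → mixedSpace (Fp L)), ℂ)) (φ : FinSB (Fp L) (Fin n'')),
        Tg (pairRep (Fp L) L (IsCMField.complexConj L) (n + n) 1 e₁ (Matrix.diagonal (dD L e dV hdV dW hdW)) (JW (Fp L) L a')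
            (chiSplittingLine L e₁ (dD L e dV hdV dW hdW) (dD_conj L e dV hdV dW hdW) (dD_ne_zero L e dV hdV dW hdW hdV0 hdW0)
              (toHeckeCharacter L lam) (isUnitary_toHeckeCharacter L lam)
              ((isOscillatorChar_toHeckeCharacter_iff lam).mpr hlam) (TW (Fp L) a')
              (isUnit_det_TW (Fp L) a') (JW (Fp L) L a') (JW_eq (Fp L) L a'))
            (toDiagA L e dV hdV dW hdW ((ι z : unipDelta L e dV hdV dW hdW) : HA L e dV hdV dW hdW), 1)
            (Tg.symm (piSchwartzBruhatEquiv (Fp L) (Fin n'') (Φinf ⊗ₜ[ℂ] φ)))) =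
          piSchwartzBruhatEquiv (Fp L) (Fin n'') (Φinf ⊗ₜ[ℂ] ρf z φ) := by
  refine ⟨(MpPsi.toOp (adelicSchrodinger (Fp L) (Fin n'')
    (adelicGram (Fp L) e₁ (realDiagonal L (dD L e dV hdV dW hdW) (dD_conj L e dV hdV dW hdW)) (TW (Fp L) a'))) q).symm, fun z Φinf φ => ?_⟩
  rw [LinearEquiv.symm_symm, hρf z φ]
  exact pairRep_line_kappaModel_tmul L e dV hdV dW hdW e₁ hdV0 hdW0 lam hlam a' g q hqc hq hj (ι z).2 (ha z) (hS z) (hS0 z) Φinf φ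

set_option maxHeartbeats 1000000 in -- idem
/-- **… at a RATIONAL Cayley mover `κ′ ∈ Sp_{2n″}(L⁺)`** (F0P2-p10 (g3)'s FILE 2 orientation): `g := (ratSp κ′)⁻¹`, `q := r_F(κ′)⁻¹` (★ `ratThetaLiftCont`), membership letter
`hj : ratSp κ′ · ι(p ⊗ 1) · (ratSp κ′)⁻¹ ∈ P_𝕐(T₁)` and readings of `ratSp κ′ · ι(ι z ⊗ 1) · (ratSp κ′)⁻¹`; then `Tg = ω(r_F κ′)` — the GLOBAL Cayley-mover model
of the census (B1c′).  [cite: Weil1964, Chap. III n° 40–41 pp. 190–193] [cite: Kudla1994, §3] [cite: Liu2021, App. B Prop. B.8 p. 104] -/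
theorem exists_Tg_pairRep_line_of_cayley (κ' : Matrix.symplecticGroup (Fin n'') (Fp L))
    (hj : ∀ p : ↥(siegelDelta L e dV hdV dW hdW),
      ratSp (Fp L) (adelicGram (Fp L) e₁ (realDiagonal L (dD L e dV hdV dW hdW) (dD_conj L e dV hdV dW hdW)) (TW (Fp L) a'))
          (isUnit_det_adelicGram (Fp L) e₁
            (isUnit_det_realDiagonal L (dD L e dV hdV dW hdW) (dD_conj L e dV hdV dW hdW) (dD_ne_zero L e dV hdV dW hdW hdV0 hdW0))
            (isUnit_det_TW (Fp L) a')) κ' *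
        toSp (Fp L) L (IsCMField.complexConj L) (n + n) 1 e₁ (Matrix.diagonal (dD L e dV hdV dW hdW)) (JW (Fp L) L a')
          (complexConj_imagUnit L) (imagUnit_ne_zero L) (imagUnit_mul_self L)
          (realDiagonal_isSymm L (dD L e dV hdV dW hdW) (dD_conj L e dV hdV dW hdW)) (isSymm_TW (Fp L) a')
          (realDiagonal_map L (dD L e dV hdV dW hdW) (dD_conj L e dV hdV dW hdW)).symm (JW_eq (Fp L) L a')
          (UnitaryGroup.adelicInl (Fp L) L (IsCMField.complexConj L) (n + n) 1 (Matrix.diagonal (dD L e dV hdV dW hdW)) (JW (Fp L) L a')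
            (toDiagA L e dV hdV dW hdW (p : HA L e dV hdV dW hdW))) *
        (ratSp (Fp L) (adelicGram (Fp L) e₁ (realDiagonal L (dD L e dV hdV dW hdW) (dD_conj L e dV hdV dW hdW)) (TW (Fp L) a'))
          (isUnit_det_adelicGram (Fp L) e₁
            (isUnit_det_realDiagonal L (dD L e dV hdV dW hdW) (dD_conj L e dV hdV dW hdW) (dD_ne_zero L e dV hdV dW hdW hdV0 hdW0))
            (isUnit_det_TW (Fp L) a')) κ')⁻¹ ∈
        siegelParabolicPi (adelicGram (Fp L) e₁ (realDiagonal L (dD L e dV hdV dW hdW) (dD_conj L e dV hdV dW hdW)) (TW (Fp L) a')))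
    {Z : Type*} [Group Z] (ι : Z → ↥(unipDelta L e dV hdV dW hdW)) (S : Z → Matrix (Fin n'') (Fin n'') (AdeleRing (𝓞 (Fp L)) (Fp L)))
    (ha : ∀ z, SiegelParabolicPi.aInvMat (
        ratSp (Fp L) (adelicGram (Fp L) e₁ (realDiagonal L (dD L e dV hdV dW hdW) (dD_conj L e dV hdV dW hdW)) (TW (Fp L) a'))
          (isUnit_det_adelicGram (Fp L) e₁
            (isUnit_det_realDiagonal L (dD L e dV hdV dW hdW) (dD_conj L e dV hdV dW hdW) (dD_ne_zero L e dV hdV dW hdW hdV0 hdW0))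
            (isUnit_det_TW (Fp L) a')) κ' *
        toSp (Fp L) L (IsCMField.complexConj L) (n + n) 1 e₁ (Matrix.diagonal (dD L e dV hdV dW hdW)) (JW (Fp L) L a')
          (complexConj_imagUnit L) (imagUnit_ne_zero L) (imagUnit_mul_self L)
          (realDiagonal_isSymm L (dD L e dV hdV dW hdW) (dD_conj L e dV hdV dW hdW)) (isSymm_TW (Fp L) a')
          (realDiagonal_map L (dD L e dV hdV dW hdW) (dD_conj L e dV hdV dW hdW)).symm (JW_eq (Fp L) L a')
          (UnitaryGroup.adelicInl (Fp L) L (IsCMField.complexConj L) (n + n) 1 (Matrix.diagonal (dD L e dV hdV dW hdW)) (JW (Fp L) L a')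
            (toDiagA L e dV hdV dW hdW ((ι z : ↥(unipDelta L e dV hdV dW hdW)) : HA L e dV hdV dW hdW))) *
        (ratSp (Fp L) (adelicGram (Fp L) e₁ (realDiagonal L (dD L e dV hdV dW hdW) (dD_conj L e dV hdV dW hdW)) (TW (Fp L) a'))
          (isUnit_det_adelicGram (Fp L) e₁
            (isUnit_det_realDiagonal L (dD L e dV hdV dW hdW) (dD_conj L e dV hdV dW hdW) (dD_ne_zero L e dV hdV dW hdW hdV0 hdW0))
            (isUnit_det_TW (Fp L) a')) κ')⁻¹) = 1)
    (hS : ∀ z, (-⅟(2 : AdeleRing (𝓞 (Fp L)) (Fp L))) • SiegelParabolicPi.cMat (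
        ratSp (Fp L) (adelicGram (Fp L) e₁ (realDiagonal L (dD L e dV hdV dW hdW) (dD_conj L e dV hdV dW hdW)) (TW (Fp L) a'))
          (isUnit_det_adelicGram (Fp L) e₁
            (isUnit_det_realDiagonal L (dD L e dV hdV dW hdW) (dD_conj L e dV hdV dW hdW) (dD_ne_zero L e dV hdV dW hdW hdV0 hdW0))
            (isUnit_det_TW (Fp L) a')) κ' *
        toSp (Fp L) L (IsCMField.complexConj L) (n + n) 1 e₁ (Matrix.diagonal (dD L e dV hdV dW hdW)) (JW (Fp L) L a')
          (complexConj_imagUnit L) (imagUnit_ne_zero L) (imagUnit_mul_self L)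
          (realDiagonal_isSymm L (dD L e dV hdV dW hdW) (dD_conj L e dV hdV dW hdW)) (isSymm_TW (Fp L) a')
          (realDiagonal_map L (dD L e dV hdV dW hdW) (dD_conj L e dV hdV dW hdW)).symm (JW_eq (Fp L) L a')
          (UnitaryGroup.adelicInl (Fp L) L (IsCMField.complexConj L) (n + n) 1 (Matrix.diagonal (dD L e dV hdV dW hdW)) (JW (Fp L) L a')
            (toDiagA L e dV hdV dW hdW ((ι z : ↥(unipDelta L e dV hdV dW hdW)) : HA L e dV hdV dW hdW))) *
        (ratSp (Fp L) (adelicGram (Fp L) e₁ (realDiagonal L (dD L e dV hdV dW hdW) (dD_conj L e dV hdV dW hdW)) (TW (Fp L) a'))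
          (isUnit_det_adelicGram (Fp L) e₁
            (isUnit_det_realDiagonal L (dD L e dV hdV dW hdW) (dD_conj L e dV hdV dW hdW) (dD_ne_zero L e dV hdV dW hdW hdV0 hdW0))
            (isUnit_det_TW (Fp L) a')) κ')⁻¹) = S z)
    (hS0 : ∀ z, (S z).map (archHom (Fp L)) = 0)
    (ρf : Representation ℂ Z (FinSB (Fp L) (Fin n'')))
    (hρf : ∀ (z : Z) (φ : FinSB (Fp L) (Fin n'')), ρf z φ =
      finMulLM (finSdChar ((S z).map (RingHom.snd (InfiniteAdeleRing (Fp L)) (FiniteAdeleRing (𝓞 (Fp L)) (Fp L)))))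
        (isLocallyConstant_finSdChar _) φ) :
    ∃ Tg : ↥(piSchwartzBruhat (Fp L) (Fin n'')) ≃ₗ[ℂ] ↥(piSchwartzBruhat (Fp L) (Fin n'')),
      ∀ (z : Z) (Φinf : 𝓢((Fin n'' → mixedSpace (Fp L)), ℂ)) (φ : FinSB (Fp L) (Fin n'')),
        Tg (pairRep (Fp L) L (IsCMField.complexConj L) (n + n) 1 e₁ (Matrix.diagonal (dD L e dV hdV dW hdW)) (JW (Fp L) L a')
            (chiSplittingLine L e₁ (dD L e dV hdV dW hdW) (dD_conj L e dV hdV dW hdW) (dD_ne_zero L e dV hdV dW hdW hdV0 hdW0)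
              (toHeckeCharacter L lam) (isUnitary_toHeckeCharacter L lam)
              ((isOscillatorChar_toHeckeCharacter_iff lam).mpr hlam) (TW (Fp L) a')
              (isUnit_det_TW (Fp L) a') (JW (Fp L) L a') (JW_eq (Fp L) L a'))
            (toDiagA L e dV hdV dW hdW ((ι z : unipDelta L e dV hdV dW hdW) : HA L e dV hdV dW hdW), 1)
            (Tg.symm (piSchwartzBruhatEquiv (Fp L) (Fin n'') (Φinf ⊗ₜ[ℂ] φ)))) =
          piSchwartzBruhatEquiv (Fp L) (Fin n'') (Φinf ⊗ₜ[ℂ] ρf z φ) := by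
  -- `g := (ratSp κ′)⁻¹`, `q := r_F(κ′)⁻¹`; then `g⁻¹ = ratSp κ′` and `π(q) = g`
  have hg : ∀ x : symplecticGroup (polar (adelicForm (Fp L) (Fin n'')
      (adelicGram (Fp L) e₁ (realDiagonal L (dD L e dV hdV dW hdW) (dD_conj L e dV hdV dW hdW)) (TW (Fp L) a')))),
      ((ratSp (Fp L) (adelicGram (Fp L) e₁ (realDiagonal L (dD L e dV hdV dW hdW) (dD_conj L e dV hdV dW hdW)) (TW (Fp L) a'))
          (isUnit_det_adelicGram (Fp L) e₁
            (isUnit_det_realDiagonal L (dD L e dV hdV dW hdW) (dD_conj L e dV hdV dW hdW) (dD_ne_zero L e dV hdV dW hdW hdV0 hdW0))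
            (isUnit_det_TW (Fp L) a')) κ')⁻¹)⁻¹ * x *
        (ratSp (Fp L) (adelicGram (Fp L) e₁ (realDiagonal L (dD L e dV hdV dW hdW) (dD_conj L e dV hdV dW hdW)) (TW (Fp L) a'))
          (isUnit_det_adelicGram (Fp L) e₁
            (isUnit_det_realDiagonal L (dD L e dV hdV dW hdW) (dD_conj L e dV hdV dW hdW) (dD_ne_zero L e dV hdV dW hdW hdV0 hdW0))
            (isUnit_det_TW (Fp L) a')) κ')⁻¹ =
      ratSp (Fp L) (adelicGram (Fp L) e₁ (realDiagonal L (dD L e dV hdV dW hdW) (dD_conj L e dV hdV dW hdW)) (TW (Fp L) a'))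
          (isUnit_det_adelicGram (Fp L) e₁
            (isUnit_det_realDiagonal L (dD L e dV hdV dW hdW) (dD_conj L e dV hdV dW hdW) (dD_ne_zero L e dV hdV dW hdW hdV0 hdW0))
            (isUnit_det_TW (Fp L) a')) κ' * x *
        (ratSp (Fp L) (adelicGram (Fp L) e₁ (realDiagonal L (dD L e dV hdV dW hdW) (dD_conj L e dV hdV dW hdW)) (TW (Fp L) a'))
          (isUnit_det_adelicGram (Fp L) e₁
            (isUnit_det_realDiagonal L (dD L e dV hdV dW hdW) (dD_conj L e dV hdV dW hdW) (dD_ne_zero L e dV hdV dW hdW hdV0 hdW0))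
            (isUnit_det_TW (Fp L) a')) κ')⁻¹ := fun x => by rw [inv_inv]
  have hq : MpPsi.proj _ (((ratThetaLiftCont (Fp L)
      (adelicGram (Fp L) e₁ (realDiagonal L (dD L e dV hdV dW hdW) (dD_conj L e dV hdV dW hdW)) (TW (Fp L) a'))
      (isUnit_det_adelicGram (Fp L) e₁
        (isUnit_det_realDiagonal L (dD L e dV hdV dW hdW) (dD_conj L e dV hdV dW hdW) (dD_ne_zero L e dV hdV dW hdW hdV0 hdW0))
        (isUnit_det_TW (Fp L) a')) κ')⁻¹ :
        adelicMpCont (Fp L) (Fin n'') (adelicGram (Fp L) e₁ (realDiagonal L (dD L e dV hdV dW hdW) (dD_conj L e dV hdV dW hdW)) (TW (Fp L) a'))) :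
        adelicMp (Fp L) (Fin n'') (adelicGram (Fp L) e₁ (realDiagonal L (dD L e dV hdV dW hdW) (dD_conj L e dV hdV dW hdW)) (TW (Fp L) a'))) =
      (ratSp (Fp L) (adelicGram (Fp L) e₁ (realDiagonal L (dD L e dV hdV dW hdW) (dD_conj L e dV hdV dW hdW)) (TW (Fp L) a'))
          (isUnit_det_adelicGram (Fp L) e₁
            (isUnit_det_realDiagonal L (dD L e dV hdV dW hdW) (dD_conj L e dV hdV dW hdW) (dD_ne_zero L e dV hdV dW hdW hdV0 hdW0))
            (isUnit_det_TW (Fp L) a')) κ')⁻¹ := by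
    rw [← adelicMpCont.proj_apply, map_inv, proj_ratThetaLiftCont]
  refine exists_Tg_pairRep_line_of_readings L e dV hdV dW hdW e₁ hdV0 hdW0 lam hlam a' _ _ (SetLike.coe_mem _) hq
    (fun p => (hg _).symm ▸ hj p) ι S (fun z => ?_) (fun z => ?_) hS0 ρf hρf
  · rw [hg]; exact ha z
  · rw [hg]; exact hS z

end Shape

end Summit.HodgeConjecture.HodgeConjecture.Cruxes.HLiu418.K2LiuLinePairKappaModelLetter

end
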